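import Literature.Computability.MetaComplexity.MCSPProofs
import Literature.Computability.MetaComplexity.McKayMurrayWilliams2019.UniformStreaming
import HarnessLib

/-!
# A one-pass streaming algorithm for `MCSP[s]` keeping one consistent program

Solo work (`solo-PneNP-blind`), Layer 1 of a fact-free uniform magnification theorem.

The streaming algorithm `CStream.alg s sel` reads a truth table `x` (`N = |x| = 2ⁿ`) bit by bit
and keeps the state `⟨bin j, a D⟩`: the number `j` of bits read, a liveness bit `a`, and — while
alive — a *clean* program `D` of the circuit evaluator (`CircuitEvalPrograms.lean`: `isClean`,
`tabCount`, `evalFn`) with at most `s n` table instructions and length `≤ K s n`, whose answers on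
the rows `0, …, j - 1` are the bits read so far.  On the next bit `b` it asks an abstract
**selector** `sel N j D b` for a program `D'` agreeing with `D` on the rows `< j` and answering
`b` on row `j`; if the returned program is good (`Good`, decidable) it becomes the new state,
otherwise the run dies.  Acceptance: `N` is a power of two and the run is alive.

Main results, for every size function with `n ≤ s n` and every selector that returns a good
program whenever one exists (hypothesis `hsel`):

* `CStream.alg_decides` — the algorithm decides `MCSPSize s` (soundness: Theorem R of the evaluator,
  `exists_circuit_evalFn`; completeness: the program `progOf C` of an optimal circuit is good at
  every step, `vmSpec_progOf`);
* `CStream.alg_runsInSpace` — every reached state has length `≤ 2 size N + K s (log₂ N) + 3`;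
* `CStream.reach_alg` — the reached state in closed form (`runA`, a left fold of `stepA`).

No machine is programmed here: the selector is a parameter.  Layer 2 supplies, under `P = NP`, a
selector computed by a uniform polynomial-time machine (search-to-decision,
`SearchToDecision.lean`), which puts `MCSPSize s` in the uniform class `USTREAM` of
`McKayMurrayWilliams2019/UniformStreaming.lean`.

References: D. M. McKay, C. D. Murray, R. R. Williams, *Weak lower bounds on resource-bounded
compression imply strong separations of complexity classes*, STOC 2019, §1.1 (Thm. 1.3) and §2
[McKayMurrayWilliams2019]; S. Arora, B. Barak, *Computational Complexity*, CUP 2009, Rem. 6.4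
(circuit evaluation) [AroraBarak2009].
-/

namespace Summit.PneNP.PneNP.Theorems.SoloBlind

open Computability
open Literature.Computability.Complexity Literature.Computability.Complexity.CircEval
open Literature.Computability.MetaComplexity Literature.Computability.MetaComplexity.MCSPVerif
open Literature.Computability.MetaComplexity.McKayMurrayWilliams2019

namespace CStream

variable (s : ℕ → ℕ)

/-! ### Programs, rows, admissibility -/

/-- The length budget of programs at `n` inputs: `(s n + 1) (8 (n + s n) + 10)`, the length of the
program of a circuit of size `≤ s n` (`length_progOf_le`). [folklore] -/
def K (n : ℕ) : ℕ := (s n + 1) * (8 * (n + s n) + 10)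

/-- The answer of the program `D` (read as a program on `n` inputs) on row `t` of a truth table:
the evaluator on `⟨lowBits n t, D⟩`. [cite: AroraBarak2009, Rem. 6.4] -/
def ev (n : ℕ) (D : List Bool) (t : ℕ) : Bool :=
  (evalFn (boolPair (List.ofFn (lowBits n t)) D)).headD false

/-- Admissible programs at `n` inputs: clean, at most `s n` table instructions (and `s n ≥ 1`),
length within the budget. [folklore] -/
def Adm (n : ℕ) (D : List Bool) : Bool :=
  isClean D && decide (tabCount D ≤ s n) && decide (1 ≤ s n) && decide (D.length ≤ K s n)

/-- Unfolding of admissibility. [folklore] -/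
theorem adm_iff (n : ℕ) (D : List Bool) :
    Adm s n D = true ↔ isClean D = true ∧ tabCount D ≤ s n ∧ 1 ≤ s n ∧ D.length ≤ K s n := by
  simp only [Adm, Bool.and_eq_true, decide_eq_true_eq, and_assoc]

/-- A good successor program at input length `N`, after `j` rows, for the current program `D` and
the next bit `b`: admissible, agreeing with `D` on the rows `< j` (within the table), answering `b`
on row `j`. [folklore] -/
def Good (N j : ℕ) (D : List Bool) (b : Bool) (D' : List Bool) : Bool :=
  Adm s (Nat.log 2 N) D' &&
    decide (∀ t < j, t < N → ev (Nat.log 2 N) D' t = ev (Nat.log 2 N) D t) &&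
      decide (ev (Nat.log 2 N) D' j = b)

/-- Unfolding of goodness. [folklore] -/
theorem good_iff (N j : ℕ) (D : List Bool) (b : Bool) (D' : List Bool) :
    Good s N j D b D' = true ↔ Adm s (Nat.log 2 N) D' = true ∧
      (∀ t < j, t < N → ev (Nat.log 2 N) D' t = ev (Nat.log 2 N) D t) ∧ ev (Nat.log 2 N) D' j = b := by
  simp only [Good, Bool.and_eq_true, decide_eq_true_eq, and_assoc]

/-- Selectors: `sel N j D b` proposes the next program; a selector is *correct* (the hypothesis
`hsel` below) if it returns a good program whenever one exists. [folklore] -/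
abbrev Sel : Type := ℕ → ℕ → List Bool → Bool → List Bool

/-! ### States -/

/-- The state `⟨bin j, a D⟩`. [folklore] -/
def encSt (j : ℕ) (a : Bool) (D : List Bool) : List Bool :=
  boolPair (encodeNat j) (a :: D)

/-- The row counter of a state. [folklore] -/
def decJ (σ : List Bool) : ℕ := bitsToNat (fstP σ)

/-- The liveness bit of a state. [folklore] -/
def decA (σ : List Bool) : Bool := (sndP σ).headD false

/-- The program of a state. [folklore] -/
def decD (σ : List Bool) : List Bool := (sndP σ).tail

/-- Reading the counter. [folklore] -/
@[simp] theorem decJ_encSt (j : ℕ) (a : Bool) (D : List Bool) : decJ (encSt j a D) = j := by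
  simp [decJ, encSt]

/-- Reading the liveness bit. [folklore] -/
@[simp] theorem decA_encSt (j : ℕ) (a : Bool) (D : List Bool) : decA (encSt j a D) = a := by
  simp [decA, encSt]

/-- Reading the program. [folklore] -/
@[simp] theorem decD_encSt (j : ℕ) (a : Bool) (D : List Bool) : decD (encSt j a D) = D := by
  simp [decD, encSt]

/-- States are nonempty (so never confused with the initial state). [folklore] -/
theorem encSt_ne_nil (j : ℕ) (a : Bool) (D : List Bool) : encSt j a D ≠ [] := by
  simp [encSt, boolPair]

/-- Length of a state. [folklore] -/
theorem length_encSt (j : ℕ) (a : Bool) (D : List Bool) :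
    (encSt j a D).length = 2 * j.size + 3 + D.length := by
  simp only [encSt, length_boolPair, List.length_cons, TM2Pass.length_encodeNat_eq_size]
  omega

/-! ### The algorithm -/

variable (sel : Sel)

/-- One abstract step on `(j, a, D)`. [folklore] -/
def stepA (N : ℕ) (st : ℕ × Bool × List Bool) (b : Bool) : ℕ × Bool × List Bool :=
  if st.2.1 = true ∧ Good s N st.1 st.2.2 b (sel N st.1 st.2.2 b) = true then
    (st.1 + 1, true, sel N st.1 st.2.2 b)
  else (st.1 + 1, false, [])

/-- The abstract run on a prefix, from `(0, alive, [])`. [folklore] -/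
def runA (N : ℕ) (p : List Bool) : ℕ × Bool × List Bool :=
  p.foldl (stepA s sel N) (0, true, [])

/-- The encoded step. [folklore] -/
def next (N j : ℕ) (a : Bool) (D : List Bool) (b : Bool) : List Bool :=
  encSt (stepA s sel N (j, a, D) b).1 (stepA s sel N (j, a, D) b).2.1 (stepA s sel N (j, a, D) b).2.2

/-- The update map: the empty (initial) state is read as `(0, alive, [])`. [folklore] -/
def update (N : ℕ) (σ : List Bool) (b : Bool) : List Bool :=
  if σ = [] then next s sel N 0 true [] b else next s sel N (decJ σ) (decA σ) (decD σ) b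

/-- Acceptance: `N` is a power of two and the run is alive. [folklore] -/
def accept (N : ℕ) (σ : List Bool) : Bool :=
  decide (N = 2 ^ Nat.log 2 N) && decA σ

/-- **The streaming algorithm** with selector `sel`. [cite: McKayMurrayWilliams2019, §2 (Streaming Algorithms)] -/
def alg : StreamingAlgorithm where
  init _ := []
  update := update s sel
  accept := accept

/-- The initial state is empty. [folklore] -/
@[simp] theorem alg_init (N : ℕ) : (alg s sel).init N = [] := rfl

/-- One more bit is one more abstract step. [folklore] -/
theorem runA_append_singleton (N : ℕ) (p : List Bool) (b : Bool) :
    runA s sel N (p ++ [b]) = stepA s sel N (runA s sel N p) b := by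
  simp [runA, List.foldl_append]

/-- **The reached state in closed form.** [folklore] -/
theorem reach_alg (N : ℕ) (p : List Bool) (hp : p ≠ []) :
    reach (alg s sel) N p =
      encSt (runA s sel N p).1 (runA s sel N p).2.1 (runA s sel N p).2.2 := by
  induction p using List.reverseRecOn with
  | nil => exact absurd rfl hp
  | append_singleton p b ih =>
    rw [reach_append_singleton, runA_append_singleton]
    by_cases hq : p = []
    · subst hq
      simp [alg, update, next, runA]
    · rw [ih hq]
      simp [alg, update, next, encSt_ne_nil]

/-- The counter counts the bits read. [folklore] -/
theorem runA_fst (N : ℕ) (p : List Bool) : (runA s sel N p).1 = p.length := by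
  induction p using List.reverseRecOn with
  | nil => rfl
  | append_singleton p b ih =>
    rw [runA_append_singleton, stepA]
    split_ifs <;> simp [ih]

/-- A dead run carries the empty program. [folklore] -/
theorem runA_dead (N : ℕ) (p : List Bool) (h : (runA s sel N p).2.1 = false) : (runA s sel N p).2.2 = [] := by
  induction p using List.reverseRecOn with
  | nil => simp [runA] at h
  | append_singleton p b ih =>
    rw [runA_append_singleton, stepA] at h ⊢
    split_ifs at h ⊢ with hc
    simp_all

/-- **Soundness invariant**: a live run on a nonempty prefix holds an admissible program consistent
with the prefix. [folklore] -/
theorem runA_sound (N : ℕ) (p : List Bool) (hp : p ≠ []) (h : (runA s sel N p).2.1 = true) :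
    Adm s (Nat.log 2 N) (runA s sel N p).2.2 = true ∧
      ∀ t < p.length, t < N → ev (Nat.log 2 N) (runA s sel N p).2.2 t = p.getD t false := by
  induction p using List.reverseRecOn with
  | nil => exact absurd rfl hp
  | append_singleton p b ih =>
    rw [runA_append_singleton] at h ⊢
    by_cases hc : (runA s sel N p).2.1 = true ∧
        Good s N (runA s sel N p).1 (runA s sel N p).2.2 b (sel N (runA s sel N p).1 (runA s sel N p).2.2 b) = true
    · have hst : stepA s sel N (runA s sel N p) b =
          ((runA s sel N p).1 + 1, true, sel N (runA s sel N p).1 (runA s sel N p).2.2 b) := if_pos hc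
      rw [hst]
      dsimp only
      obtain ⟨ha, hg⟩ := hc
      obtain ⟨hadm, hagree, hrow⟩ := (good_iff s _ _ _ _ _).1 hg
      rw [runA_fst] at hadm hagree hrow ⊢
      refine ⟨hadm, fun t ht htN => ?_⟩
      rw [List.length_append, List.length_singleton] at ht
      rcases Nat.lt_or_eq_of_le (Nat.le_of_lt_succ ht) with hlt | rfl
      · rw [hagree t hlt htN, List.getD_append _ _ _ _ hlt]
        by_cases hq : p = []
        · subst hq; simp at hlt
        · exact (ih hq ha).2 t hlt htN
      · rw [hrow, List.getD_append_right _ _ _ _ le_rfl]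
        simp
    · have hst : stepA s sel N (runA s sel N p) b = ((runA s sel N p).1 + 1, false, []) := if_neg hc
      rw [hst] at h
      simp at h

/-- **Completeness invariant**: if some admissible program is consistent with the prefix (of length
`≤ N`), the run is alive. [folklore] -/
theorem runA_complete
    (hsel : ∀ N j D b D₀, Good s N j D b D₀ = true → Good s N j D b (sel N j D b) = true)
    (N : ℕ) (p : List Bool) (hpN : p.length ≤ N)
    (hex : ∃ D₀, Adm s (Nat.log 2 N) D₀ = true ∧ ∀ t < p.length, ev (Nat.log 2 N) D₀ t = p.getD t false) :
    (runA s sel N p).2.1 = true := by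
  induction p using List.reverseRecOn with
  | nil => simp [runA]
  | append_singleton p b ih =>
    obtain ⟨D₀, hD₀, hcons⟩ := hex
    rw [List.length_append, List.length_singleton] at hpN hcons
    have hcons' : ∀ t < p.length, ev (Nat.log 2 N) D₀ t = p.getD t false := fun t ht => by
      rw [hcons t (by omega), List.getD_append _ _ _ _ ht]
    have ha := ih (by omega) ⟨D₀, hD₀, hcons'⟩
    -- `D₀` is a good successor of the current program
    have hgood : Good s N (runA s sel N p).1 (runA s sel N p).2.2 b D₀ = true := by
      rw [runA_fst, good_iff]
      refine ⟨hD₀, fun t ht htN => ?_, ?_⟩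
      · rw [hcons' t ht]
        by_cases hq : p = []
        · subst hq; simp at ht
        · exact ((runA_sound s sel N p hq ha).2 t ht htN).symm
      · rw [hcons p.length (by omega), List.getD_append_right _ _ _ _ le_rfl]
        simp
    have hc : (runA s sel N p).2.1 = true ∧
        Good s N (runA s sel N p).1 (runA s sel N p).2.2 b (sel N (runA s sel N p).1 (runA s sel N p).2.2 b) = true :=
      ⟨ha, hsel _ _ _ _ _ hgood⟩
    rw [runA_append_singleton]
    have hst : stepA s sel N (runA s sel N p) b =
        ((runA s sel N p).1 + 1, true, sel N (runA s sel N p).1 (runA s sel N p).2.2 b) := if_pos hc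
    rw [hst]

/-! ### Rows and truth tables -/

/-- The row `t < 2ⁿ` of the truth table of `f` is `f (lowBits n t)`. [folklore] -/
theorem getD_truthTable {n : ℕ} (f : (Fin n → Bool) → Bool) (t : ℕ) (ht : t < 2 ^ n) :
    (truthTable f).getD t false = f (lowBits n t) := by
  rw [List.getD_eq_getElem _ _ (by simpa using ht), getElem_truthTable]

/-- The program of a `B₂`-circuit answers row `t` with the circuit's value. [cite: AroraBarak2009, Rem. 6.4] -/
theorem ev_progOf {n : ℕ} (C : Circuit (Fin n)) (hB : C.IsOver B2) (t : ℕ) :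
    ev n (progOf C) t = C.eval (lowBits n t) := by
  rw [ev, evalFn_boolPair, vmSpec_progOf C (arity_le_of_isOver hB)]
  rfl

/-! ### Correctness -/

/-- **Soundness**: an accepted word is a truth table of circuit complexity `≤ s n`. [cite: McKayMurrayWilliams2019, §2] -/
theorem mem_of_accepts (x : List Bool) (h : (alg s sel).Accepts x) : x ∈ MCSPSize s := by
  have hacc : accept x.length (reach (alg s sel) x.length x) = true := h
  rw [accept, Bool.and_eq_true, decide_eq_true_eq] at hacc
  obtain ⟨hpow, halive⟩ := hacc
  have hx : x ≠ [] := by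
    rintro rfl
    simp at hpow
  set N := x.length with hN
  set n := Nat.log 2 N with hn
  rw [reach_alg s sel N x hx, decA_encSt] at halive
  obtain ⟨hadm, hcons⟩ := runA_sound s sel N x hx halive
  obtain ⟨hclean, htab, hs1, -⟩ := (adm_iff s _ _).1 hadm
  set D := (runA s sel N x).2.2 with hD
  -- the function tabulated by `x`
  have hlen : x.length = 2 ^ n := hpow
  set f : (Fin n → Bool) → Bool := ofTruthTable x hlen with hf
  have htf : truthTable f = x := truthTable_ofTruthTable x hlen
  -- Theorem R: the program computes a small circuit, which computes `f`
  obtain ⟨C, hB, hsize, hC⟩ := exists_circuit_evalFn n D hclean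
  have hcomp : C.Computes f := by
    intro v
    have hi := (boolFunEquivFin n v).isLt
    have hv : lowBits n (boolFunEquivFin n v) = v := by
      rw [← boolFunEquivFin_symm_apply, Equiv.symm_apply_apply]
    have h1 := hcons (boolFunEquivFin n v) (by omega) (by omega)
    rw [ev, hv, hC v] at h1
    simp only [List.headD_cons] at h1
    rw [h1, ← htf, getD_truthTable f _ hi, hv]
  rw [← htf, truthTable_mem_MCSPSize_iff]
  refine (circuitSizeOver_le_of_computes C hB hcomp).trans (hsize.trans ?_)
  exact max_le htab hs1

/-- **Completeness**: every truth table of circuit complexity `≤ s n` is accepted, provided the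
selector is correct and `n ≤ s n`. [cite: McKayMurrayWilliams2019, §2] -/
theorem accepts_of_mem (hs : ∀ n, n ≤ s n)
    (hsel : ∀ N j D b D₀, Good s N j D b D₀ = true → Good s N j D b (sel N j D b) = true)
    (x : List Bool) (h : x ∈ MCSPSize s) : (alg s sel).Accepts x := by
  obtain ⟨n, f, rfl, hfs⟩ := h
  have hN : (truthTable f).length = 2 ^ n := length_truthTable f
  have hlog : Nat.log 2 (truthTable f).length = n := by rw [hN, Nat.log_pow (by norm_num)]
  have hx : truthTable f ≠ [] := by
    intro he; have := congrArg List.length he; simp at this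
  -- an optimal circuit and its program
  obtain ⟨C₀, hB₀, hs₀, hC₀⟩ := (cktSize_univ_fin n fun v (_ : Unit) => f v).toCircuit
  obtain ⟨C, hB, hCf, hCs⟩ := exists_circuit_size_eq_circuitSizeOver ⟨C₀, hB₀, hC₀⟩
  have hCle : C.size ≤ s n := hCs ▸ hfs
  have hs1 : 1 ≤ s n := by
    by_cases h0 : C.size = 0
    · have hg : C.gates = [] := List.eq_nil_of_length_eq_zero h0
      cases ho : C.output with
      | inl j => exact le_trans (Nat.succ_le_of_lt j.isLt) (hs n) |>.trans' (by omega)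
      | inr m => exact absurd (C.wf_output m ho) (by simp [hg])
    · omega
  have hadm : Adm s n (progOf C) = true := by
    rw [adm_iff]
    refine ⟨isClean_progOf C, by simpa using hCle, hs1, ?_⟩
    exact (length_progOf_le C).trans (Nat.mul_le_mul (by omega) (by omega))
  -- the run is alive at the end
  have halive : (runA s sel (truthTable f).length (truthTable f)).2.1 = true := by
    refine runA_complete s sel hsel _ _ le_rfl ⟨progOf C, by rw [hlog]; exact hadm, fun t ht => ?_⟩
    rw [hlog, ev_progOf C hB, hCf, getD_truthTable f t (hN ▸ ht)]
  change accept (truthTable f).length (reach (alg s sel) (truthTable f).length (truthTable f)) = true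
  rw [reach_alg s sel _ _ hx, accept, decA_encSt, halive, hlog, hN]
  simp

/-- **The algorithm decides `MCSPSize s`.** [cite: McKayMurrayWilliams2019, §1.1 (Thm. 1.3)] -/
theorem alg_decides (hs : ∀ n, n ≤ s n)
    (hsel : ∀ N j D b D₀, Good s N j D b D₀ = true → Good s N j D b (sel N j D b) = true) :
    (alg s sel).Decides (MCSPSize s) :=
  fun x => ⟨mem_of_accepts s sel x, accepts_of_mem s sel hs hsel x⟩

/-! ### Space -/

/-- **Space**: every reached state has length `≤ 2 size N + K s (log₂ N) + 3`. [cite: McKayMurrayWilliams2019, §2] -/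
theorem alg_runsInSpace :
    RunsInSpace (alg s sel) (fun N => 2 * N.size + K s (Nat.log 2 N) + 3) := by
  intro N p hp
  dsimp only
  by_cases hq : p = []
  · subst hq; simp
  rw [reach_alg s sel N p hq, length_encSt, runA_fst]
  have hj : p.length.size ≤ N.size := Nat.size_le_size hp
  have hD : (runA s sel N p).2.2.length ≤ K s (Nat.log 2 N) := by
    cases ha : (runA s sel N p).2.1 with
    | false => rw [runA_dead s sel N p ha]; simp
    | true => exact ((adm_iff s _ _).1 (runA_sound s sel N p hq ha).1).2.2.2
  omega

/-- The update and acceptance maps of the algorithm, restated for the machine layer. [folklore] -/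
theorem alg_update (N : ℕ) (σ : List Bool) (b : Bool) : (alg s sel).update N σ b = update s sel N σ b := rfl

/-- The acceptance map of the algorithm, restated for the machine layer. [folklore] -/
theorem alg_accept (N : ℕ) (σ : List Bool) : (alg s sel).accept N σ = accept N σ := rfl

end CStream

end Summit.PneNP.PneNP.Theorems.SoloBlind
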